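import Literature.AlgebraicGeometry.ShimuraVarieties.UnitaryAuxiliaryExtLevelQuotient
import HarnessLib

/-!
# The Ext-tower level change as a quotient by the FINITE group `(K × L₀)/(K_V × L_V)`
# ([Deligne1979ShimuraVarieties] 2.7.1 (c) «the finite quotient `K/L`», 2.1.2–2.1.4; [Milne2005ShimuraVarieties] Rem. 5.29 (c))

Topic `AlgebraicGeometry/ShimuraVarieties`; namespaces `Literature.AlgebraicGeometry.Motives` (§1, one generic lemma) and
`Literature.AlgebraicGeometry.ShimuraVarieties.UnitaryCanonicalModel.Aux` (§2–§3).  THEOREMS ONLY: no definition, no named fact, no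
instance, no `sorry`.  Cell hodgecm-mathlib (D-0151), hDel line I-1′, receptacle v4 «Q-architecture», `stub_Squot` step D1 («D1-PACK»,
B-p01's Squot table): the packaging of ★ `Aux.complexSystemExt_isLevelQuotient` (Q4) through the finite quotient group, so that the
`stub_Squot` closer consumes a FINITE group `Δ := (K × L₀)/(K_V × L_V)` (as ★ `Motives.exists_isClosedImmersion_desc_of_isSepQuotient`
wants) without re-opening Q4.  HC_CM is proved only modulo the 7 printed citations until rung 0 closes; nothing here touches a floor binder.

Throughout `Γ := ↥K.1.1 × ↥L₀.1` (the compact group of ★ Q4) and the product sublevel is SPELLED OUT as the subgroup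
`(K_V.1.1.subgroupOf K.1.1).prod (L_V.1.subgroupOf L₀.1)` of `Γ` (no definition is introduced).

* §1 `Motives.IsSepQuotient.quotientLift` — a separated quotient by `act : Γ →* Aut Y` whose kernel contains a normal subgroup `N` is a
  separated quotient by the descended action `QuotientGroup.lift N act _ : Γ ⧸ N →* Aut Y` (same set of automorphisms).
* §2 `Aux.unitary_normal_of_prod_normal` (the SQuot-currency normality «`x⁻¹ y x ∈ K_V × L_V` for `x ∈ K × L₀`, `y ∈ K_V × L_V`» gives
  Q4's unitary binder `k⁻¹ n k ∈ K_V`), `Aux.prod_subgroupOf_normal` (conversely Q4's binder makes `K_V × L_V` normal in `K × L₀`, the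
  torus `T₀(M)(𝔸_f)` being commutative), `Aux.finite_quotient_prod_subgroupOf` (`(K × L₀)/(K_V × L_V)` is finite: `K_V`, `L_V` are
  open in the compact `K`, `L₀` — [Deligne1979ShimuraVarieties] 2.7.1 (c) «the finite quotient»).
* §3 `Aux.complexSystemExt_isLevelQuotient_finite` — **Q4 through the finite group**: an action
  `actΔ : (K × L₀)/(K_V × L_V) →* Aut (Sh_{K_V×L_V}(G × T₀(M), X × {h_Φ})_ℂ)` with the point formula of ★ Q4 on representatives,
  `([x, aK_V], p′) ↦ ([x, ak⁻¹K_V], [l]·p′)`, and `Motives.IsSepQuotient (fun d => actΔ d) (extLevelMap M Sc hL (homOfLE h))`.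

## References
* [Deligne1979ShimuraVarieties] P. Deligne, *Variétés de Shimura*, PSPM XXXIII.2 (1979): 2.1.2–2.1.4 (PDF p. 24 of Milne's
  translation), 2.7.1 (b)–(c) (PDF p. 47 L26–38).
* [Milne2005ShimuraVarieties] J. S. Milne, *Introduction to Shimura varieties* (2005): Rem. 5.29 (c) p. 65; Lemma 5.13 p. 57; (33) p. 58.
* [MumfordAV1970] D. Mumford, *Abelian Varieties* (1970), §7 Thm. p. 66 and Remark.
-/

set_option autoImplicit false

noncomputable section

open Function MulAction Topology NumberField CategoryTheory CategoryTheory.Limits Matrix AlgebraicGeometry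
open scoped Matrix ComplexOrder
open Literature.AlgebraicGeometry.Motives
open Literature.NumberTheory.Automorphic Literature.NumberTheory.Automorphic.UnitaryGroup
open Literature.NumberTheory.Automorphic.Liu2021.AppendixC (C5.OpenCompactSubgroup C5.SmallLevel)
open Literature.Geometry.ComplexHyperbolic Literature.Geometry.ComplexHyperbolic.BallModel
open Literature.NumberTheory.Automorphic.ShimuraDissection

/-! ## §1 Descending a separated quotient to the quotient group -/

namespace Literature.AlgebraicGeometry.Motives

universe u

/-- **A separated quotient by `Γ` acting through `act : Γ →* Aut Y` is a separated quotient by the descended action of `Γ/N`** for every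
normal subgroup `N` killed by `act` (`QuotientGroup.lift`; the acting set of automorphisms is the same — [MumfordAV1970] §7 Remark,
the categorical quotient depends only on the automorphisms). [cite: MumfordAV1970, §7 Thm. p. 66 (Remark)]
[cite: Deligne1979ShimuraVarieties, 2.7.1 (c) (PDF p. 47 L34–38)] -/
theorem IsSepQuotient.quotientLift {k : Type u} [Field k] {Y Z : SchemeOver k} {Γ : Type*} [Group Γ] (N : Subgroup Γ)
    [N.Normal] (act : Γ →* Aut Y) (hker : ∀ n ∈ N, act n = 1) {p : Y ⟶ Z}
    (hq : IsSepQuotient (fun g => act g) p) :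
    IsSepQuotient (fun d => QuotientGroup.lift N act hker d) p := by
  refine ⟨fun d => ?_, fun W f hW hf => hq.2 W f hW fun g => hf (QuotientGroup.mk g)⟩
  obtain ⟨g, rfl⟩ := QuotientGroup.mk_surjective d
  exact hq.1 g

end Literature.AlgebraicGeometry.Motives

namespace Literature.AlgebraicGeometry.ShimuraVarieties.UnitaryCanonicalModel

variable {L : Type} [Field L] [NumberField L] [IsCMField L] {H : Matrix (Fin 3) (Fin 3) L}
  {τ : L →+* ℂ} {T : GL (Fin 3) ℂ} {hT : formCongr (starRingEnd ℂ) T (H.map τ) = BallModel.J}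
  {K₀ : C5.OpenCompactSubgroup ↥(finAdelic (↥(maximalRealSubfield L)) L (IsCMField.complexConj L) 3 H)}

namespace Aux

variable (M : Type) [Field M] [NumberField M] [IsCMField M]

/-! ## §2 The product sublevel `K_V × L_V ⊴ K × L₀` and the finite quotient -/

/-- **SQuot-currency normality ⇒ Q4's unitary binder**: if `x⁻¹yx ∈ K_V × L_V` for all `x ∈ K × L₀`, `y ∈ K_V × L_V` (subgroups of
`U(H)(𝔸_{L⁺,f}) × T₀(M)(𝔸_f)`), then `k⁻¹nk ∈ K_V` for all `k ∈ K`, `n ∈ K_V` (take `x = (k,1)`, `y = (n,1)`).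
[cite: Deligne1979ShimuraVarieties, 2.7.1 (c) (PDF p. 47 L34–38)] -/
theorem unitary_normal_of_prod_normal {L₀ LV : C5.OpenCompactSubgroup ↥(torusFinAdelic M)} {K KV : C5.SmallLevel K₀}
    (hN : ∀ x ∈ K.1.1.prod L₀.1, ∀ y ∈ KV.1.1.prod LV.1, x⁻¹ * y * x ∈ KV.1.1.prod LV.1) :
    ∀ k ∈ K.1.1, ∀ n ∈ KV.1.1, k⁻¹ * n * k ∈ KV.1.1 := fun k hk n hn =>
  (Subgroup.mem_prod.1 (hN (k, 1) (Subgroup.mem_prod.2 ⟨hk, L₀.1.one_mem⟩) (n, 1)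
    (Subgroup.mem_prod.2 ⟨hn, LV.1.one_mem⟩))).1

/-- **`K_V × L_V` is normal in `K × L₀`** when `K_V` is normalised by `K` — the torus factor `T₀(M)(𝔸_f)` is commutative.
[cite: Deligne1979ShimuraVarieties, 2.7.1 (c) (PDF p. 47 L34–38)] -/
theorem prod_subgroupOf_normal {L₀ LV : C5.OpenCompactSubgroup ↥(torusFinAdelic M)} {K KV : C5.SmallLevel K₀}
    (hn : ∀ k ∈ K.1.1, ∀ n ∈ KV.1.1, k⁻¹ * n * k ∈ KV.1.1) :
    ((KV.1.1.subgroupOf K.1.1).prod (LV.1.subgroupOf L₀.1)).Normal := by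
  refine ⟨fun y hy g => ?_⟩
  rw [Subgroup.mem_prod, Subgroup.mem_subgroupOf, Subgroup.mem_subgroupOf] at hy ⊢
  refine ⟨?_, ?_⟩
  · have h1 := hn ((g.1⁻¹ : ↥K.1.1) : finAdelic (↥(maximalRealSubfield L)) L (IsCMField.complexConj L) 3 H) (g.1⁻¹).2 _ hy.1
    simpa only [Prod.fst_mul, Prod.fst_inv, Subgroup.coe_mul, Subgroup.coe_inv, inv_inv] using h1
  · have h2 : (g * y * g⁻¹).2 = y.2 := by
      rw [Prod.snd_mul, Prod.snd_mul, Prod.snd_inv, mul_comm g.2 y.2, mul_inv_cancel_right]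
    rw [h2]
    exact hy.2

/-- **`(K × L₀)/(K_V × L_V)` is finite** ([Deligne1979ShimuraVarieties] 2.7.1 (c) «the finite quotient `K/L`»): `K_V`, `L_V` are open
(open compact levels) inside the compact `K`, `L₀`, so the product sublevel is an open subgroup of a compact group.
[cite: Deligne1979ShimuraVarieties, 2.7.1 (c) (PDF p. 47 L34–38)] [cite: Milne2005ShimuraVarieties, Rem. 5.29 (c) p. 65] -/
theorem finite_quotient_prod_subgroupOf (L₀ LV : C5.OpenCompactSubgroup ↥(torusFinAdelic M)) (K KV : C5.SmallLevel K₀) :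
    Finite ((↥K.1.1 × ↥L₀.1) ⧸ ((KV.1.1.subgroupOf K.1.1).prod (LV.1.subgroupOf L₀.1))) := by
  haveI : CompactSpace ↥K.1.1 := isCompact_iff_compactSpace.1 K.1.2.2
  haveI : CompactSpace ↥L₀.1 := isCompact_iff_compactSpace.1 L₀.2.2
  have hK : IsOpen ((KV.1.1.subgroupOf K.1.1 : Subgroup ↥K.1.1) : Set ↥K.1.1) := KV.1.2.1.preimage continuous_subtype_val
  have hL : IsOpen ((LV.1.subgroupOf L₀.1 : Subgroup ↥L₀.1) : Set ↥L₀.1) := LV.2.1.preimage continuous_subtype_val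
  refine Subgroup.quotient_finite_of_isOpen _ ?_
  rw [Subgroup.coe_prod]
  exact hK.prod hL

/-! ## §3 Q4 through the finite group -/

set_option maxHeartbeats 800000 in -- large adelic / Shimura-set terms
/-- **Q4 through the finite group `Δ = (K × L₀)/(K_V × L_V)`** ([Deligne1979ShimuraVarieties] 2.7.1 (c) for the product datum
`(G × T₀(M), X × {h_Φ})`; [Milne2005ShimuraVarieties] Rem. 5.29 (c)): for `L_V ≤ L₀`, small levels `K_V ≤ K` with `K_V` normalised by
`K`, and the product sublevel `N = K_V × L_V` normal in `K × L₀` (instance; `prod_subgroupOf_normal`), the action of ★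
`complexSystemExt_isLevelQuotient` descends (`QuotientGroup.lift`, it kills `N`) to `actΔ : (K × L₀)/N →* Aut (Sh_{K_V×L_V}(…)_ℂ)` with
the SAME point formula on representatives, `([x, aK_V], p′) ↦ ([x, ak⁻¹K_V], [l]·p′)`, and the level change `extLevelMap` is the
quotient by `actΔ` for separated test objects (`Motives.IsSepQuotient.quotientLift`).  The group `(K × L₀)/N` is finite
(`finite_quotient_prod_subgroupOf`).
[cite: Deligne1979ShimuraVarieties, 2.7.1 (c) (PDF p. 47 L34–38) and 2.1.2–2.1.4 (PDF p. 24 of Milne's translation)]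
[cite: Milne2005ShimuraVarieties, Rem. 5.29 (c) p. 65; Lemma 5.13 p. 57; (33) p. 58] -/
theorem complexSystemExt_isLevelQuotient_finite (Sc : ComplexRecordSystem L H τ T hT K₀)
    {LV L₀ : C5.OpenCompactSubgroup ↥(torusFinAdelic M)} (hL : LV ≤ L₀) {KV K : C5.SmallLevel K₀} (h : KV ≤ K)
    (hn : ∀ k ∈ K.1.1, ∀ n ∈ KV.1.1, k⁻¹ * n * k ∈ KV.1.1)
    [((KV.1.1.subgroupOf K.1.1).prod (LV.1.subgroupOf L₀.1)).Normal] :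
    ∃ actΔ : (↥K.1.1 × ↥L₀.1) ⧸ ((KV.1.1.subgroupOf K.1.1).prod (LV.1.subgroupOf L₀.1)) →*
        Aut ((complexSystemExt M Sc LV).obj KV),
      (∀ (k : ↥K.1.1) (l : ↥L₀.1) (p' : classGroup M LV) (x : Ball)
          (a : finAdelic (↥(maximalRealSubfield L)) L (IsCMField.complexConj L) 3 H),
          AlgPoints.map (actΔ (QuotientGroup.mk (k, l))).hom (summandPointExt M Sc LV KV p' x a) =
            summandPointExt M Sc LV KV (classOf M LV (l : ↥(torusFinAdelic M)) * p') x
              (a * ((k : finAdelic (↥(maximalRealSubfield L)) L (IsCMField.complexConj L) 3 H))⁻¹)) ∧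
      Motives.IsSepQuotient (fun d => actΔ d) (extLevelMap M Sc hL (homOfLE h)) := by
  obtain ⟨act, hpts, hker, hq⟩ := complexSystemExt_isLevelQuotient M Sc hL h hn
  have hkerN : ∀ n ∈ (KV.1.1.subgroupOf K.1.1).prod (LV.1.subgroupOf L₀.1), act n = 1 := fun n hn' => by
    rw [Subgroup.mem_prod, Subgroup.mem_subgroupOf, Subgroup.mem_subgroupOf] at hn'
    exact hker n hn'.1 hn'.2
  refine ⟨QuotientGroup.lift _ act hkerN, fun k l p' x a => ?_, Motives.IsSepQuotient.quotientLift _ act hkerN hq⟩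
  rw [QuotientGroup.lift_mk]
  exact hpts k l p' x a

end Aux

end Literature.AlgebraicGeometry.ShimuraVarieties.UnitaryCanonicalModel

end
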